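import Literature.AlgebraicGeometry.HodgeTheory.AbelianVarietyTorsionRigidity
import Literature.AlgebraicGeometry.HodgeTheory.AbelianVarietyRationalCharpoly
import Literature.AlgebraicGeometry.HodgeTheory.AbelianVarietyHOneExactness
import Literature.AlgebraicGeometry.HodgeTheory.AbelianVarietyIsogenySublatticesCohomology
import Literature.AlgebraicGeometry.Motives.AbelianVarietyHomDivisionOnPoints
import Literature.AlgebraicGeometry.Motives.AbelianVarietyWeilPairingAlgClosure
import Literature.AlgebraicGeometry.Motives.AbelianVarietyWeilPairingRadicalComposite
import Literature.AlgebraicGeometry.Motives.AbelianVarietyDegree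
import HarnessLib

/-!
# Rigidity of homomorphisms agreeing on division points up to a unit scalar; sign exclusion for
# Weil-pairing towers of ample divisors (Lange 2023, §2.4.1 mechanism; Milne 1986, §16)

Topic `AlgebraicGeometry/HodgeTheory`; namespace `Literature.AlgebraicGeometry.HodgeTheory.AbelianVariety`.
KERNEL ONLY: theorems; no definition, no named fact, no instance, no `sorry`.

Two homomorphisms `lam₁, lam₂ : A → B` of complex abelian varieties, `lam₁` an isogeny (witnessed by a
quasi-inverse `ψ` with `lam₁ ≫ ψ = n`, `ψ ≫ lam₁ = n`), which agree on the `M`-division points UP TO A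
UNIT SCALAR `a_M ∈ (ℤ/M)^×` — `lam₂(P) = lam₁(P)^{a_M}` for `P ∈ A[M](ℂ)` — for every level `M` of a
cofinal tower `N ∣ M`, satisfy `lam₂ = lam₁` or `lam₂ = -lam₁`
(`eq_or_eq_neg_of_forall_torsionPoints_map_eq_pow`).  This is the mechanism of H. Lange, *Abelian
Varieties over the Complex Numbers* (2023), §2.4.1, proof of Cor. 2.4.11 («By assumption
`X_n ⊂ ker(1_X − f)`. Hence there is a `g ∈ End(X)` such that `ng = 1_X − f`») run for the
endomorphism `β = lam₂ ≫ ψ` against the SCALARS `n·a_M` instead of the identity: the monodromy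
isomorphism `H₁(A(ℂ); ℤ)/M ≅ A[M](ℂ)` (natural in homomorphisms — the tree's
`exists_nsmul_eq_singularHomology_map_sub_of_forall_torsionPoints`) makes `ρ_r(β) ≡ n a_M (mod M)` on
the lattice `H₁(A(ℂ); ℤ) ≅ ℤ^{2g}` for unboundedly many `M`, so `ρ_r(β)` is an integer scalar `c`
(`TorsionScalarRigidity.exists_int_eq_smul_of_forall_exists_sub_smul_mem`), `β = c·1_A` by the
faithfulness of `ρ_r` ([Lange 2023, §1.1.2–1.1.3]; the tree's `hom_eq_of_singularHomology_map_one_eq`),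
`n·lam₂ = c·lam₁`, and `c ≡ n·a_M (mod M)` with `a_M` units forces `c = ±n`.

The companion SIGN EXCLUSION (`not_forall_weilPairingLevel_eq_inv_of_isAmple`): two AMPLE Cartier
divisors `Θ₁, Θ₂` on a positive-dimensional complex abelian variety cannot have inverse level Weil
pairings `ē^{Θ₂}_M = (ē^{Θ₁}_M)⁻¹` on `A[M](ℂ)` along a cofinal tower: `ē^{Θ₁+Θ₂}_M ≡ 1`
(bilinearity in the divisor, Lang VII §2 Prop. 3 — the tree's `weilPairingLevel_add`) would put every
`M`-division point in the radical, which for the ample `Θ₁ + Θ₂` is killed by the fixed power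
`ℓ^{#K(Θ₁+Θ₂)}` (Lang VII §2 Prop. 4, Mumford §6 App. 1 — the tree's
`weilPairingLevel_radical_pow_card_KTheta_of_one_lt`), contradicting `A[ℓᵏ](ℂ) ≅ (ℤ/ℓᵏ)^{2g}`.

Use (cell `hodgecm-mathlib`, M1PRIME-DAG §3 N6 / W3c (c-iii) «polarisation rigidity»): with
`lam₁ = λ′`, `lam₂ = H⁻¹ ≫ λ_σ ≫ Ĥ` the two `Λ(𝒪(Θ))`-witnessed polarisations on isomorphic marked
fibres, whose Weil-pairing towers are similitude towers of `E_δ`, the two theorems give the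
`λ`-clause `λ′ ≫ Ĝ = H ≫ λ_σ` of the pull-back relation of triples.

## References
* [Lange2023AbelianVarietiesComplex] H. Lange, *Abelian Varieties over the Complex Numbers*,
  Grundlehren Text Editions (2023), §1.1.2–§1.1.3 (rational representation, PDF pp. 19–23),
  §2.4.1 Cor. 2.4.11 and its proof (PDF p. 117).
* [Milne1986AbelianVarieties] J. S. Milne, *Abelian Varieties*, in Cornell–Silverman (1986), §16
  (p. 132, `ē_m^λ`), Prop. 17.5 (b).
* [Lang1983AbelianVarieties] S. Lang, *Abelian Varieties*, Ch. VII §2, Props. 3–4.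
* [MumfordAV1970] D. Mumford, *Abelian Varieties* (1970), §6 Application 1 (p. 60), §19, §20.
-/

noncomputable section

open Module CategoryTheory Function
open Literature.AlgebraicTopology.SingularHomology

universe u

namespace Literature.AlgebraicGeometry.HodgeTheory

/-! ## §1 Lattice lemma: an additive endomorphism of `ℤ^k` which is a scalar modulo unboundedly many `M` is a scalar -/

namespace TorsionScalarRigidity

/-- **An additive map `F : ℤ^k → ℤ^k` which is congruent to a scalar modulo every level of an
unbounded family is an integer scalar**: if for every `m` there are `M` with `m ∣ M`, `M ≠ 0`, and an
integer `s` with `F x - s • x ∈ M • ℤ^k` for all `x`, then `F = c • id` for some `c ∈ ℤ`; moreover `c`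
may be taken congruent to the given scalars (`c - s ∈ Mℤ` whenever `F x - s • x ∈ M ℤ^k` for all `x`
and `0 < k`).  Elementary: off-diagonal matrix entries are divisible by every `M`, diagonal entries
are congruent to each other modulo every `M`. [folklore] -/
private theorem exists_int_eq_smul_of_forall_exists_sub_smul_mem {k : ℕ} (F : (Fin k → ℤ) →+ (Fin k → ℤ))
    (h : ∀ m : ℕ, m ≠ 0 → ∃ M : ℕ, m ∣ M ∧ M ≠ 0 ∧ ∃ s : ℤ, ∀ x, ∃ y : Fin k → ℤ, F x - s • x = (M : ℤ) • y) :
    ∃ c : ℤ, ∀ x, F x = c • x := by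
  classical
  -- entries: `F (single j 1) i`
  -- (1) off-diagonal entries vanish, (2) diagonal entries agree
  have hdvd : ∀ m : ℕ, m ≠ 0 → ∀ i j : Fin k,
      ((m : ℤ) ∣ F (Pi.single j 1) i - if i = j then F (Pi.single i 1) i else 0) := by
    intro m hm i j
    obtain ⟨M, hmM, hM0, s, hs⟩ := h m hm
    have hmM' : (m : ℤ) ∣ (M : ℤ) := Int.natCast_dvd_natCast.mpr hmM
    by_cases hij : i = j
    · subst hij
      simp
    · rw [if_neg hij, sub_zero]
      obtain ⟨y, hy⟩ := hs (Pi.single j 1)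
      have hi := congrFun hy i
      simp only [Pi.sub_apply, Pi.smul_apply, Pi.single_apply, smul_eq_mul] at hi
      rw [if_neg hij, mul_zero, sub_zero] at hi
      exact hmM'.trans ⟨y i, hi⟩
  have hdiag : ∀ m : ℕ, m ≠ 0 → ∀ i j : Fin k, ((m : ℤ) ∣ F (Pi.single i 1) i - F (Pi.single j 1) j) := by
    intro m hm i j
    obtain ⟨M, hmM, hM0, s, hs⟩ := h m hm
    have hmM' : (m : ℤ) ∣ (M : ℤ) := Int.natCast_dvd_natCast.mpr hmM
    obtain ⟨y, hy⟩ := hs (Pi.single i 1)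
    obtain ⟨y', hy'⟩ := hs (Pi.single j 1)
    have hi := congrFun hy i
    have hj := congrFun hy' j
    simp only [Pi.sub_apply, Pi.smul_apply, Pi.single_eq_same, smul_eq_mul, mul_one] at hi hj
    have : F (Pi.single i 1) i - F (Pi.single j 1) j = (M : ℤ) * (y i - y' j) := by
      rw [mul_sub, ← hi, ← hj]; ring
    rw [this]
    exact hmM'.mul_right _
  -- an integer divisible by every positive natural number is zero
  have hzero : ∀ z : ℤ, (∀ m : ℕ, m ≠ 0 → (m : ℤ) ∣ z) → z = 0 := fun z hz => by
    have h1 := hz (z.natAbs + 1) (Nat.succ_ne_zero _)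
    rcases h1 with ⟨t, ht⟩
    rcases eq_or_ne t 0 with rfl | ht0
    · simpa using ht
    · exfalso
      have : (z.natAbs : ℤ) + 1 ≤ |z| := by
        calc ((z.natAbs : ℤ) + 1) = |((z.natAbs : ℤ) + 1)| := by
              rw [abs_of_nonneg (by positivity)]
          _ ≤ |((z.natAbs : ℤ) + 1)| * |t| := le_mul_of_one_le_right (abs_nonneg _)
              (Int.one_le_abs ht0)
          _ = |z| := by rw [← abs_mul]; exact congrArg _ (by exact_mod_cast ht.symm)
      have h2 : |z| = (z.natAbs : ℤ) := Int.abs_eq_natAbs z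
      omega
  rcases Nat.eq_zero_or_pos k with hk | hk
  · subst hk
    exact ⟨0, fun x => by ext i; exact Fin.elim0 i⟩
  · obtain ⟨i₀⟩ : Nonempty (Fin k) := ⟨⟨0, hk⟩⟩
    refine ⟨F (Pi.single i₀ 1) i₀, fun x => ?_⟩
    -- expand `x` in the standard basis
    have hx : x = ∑ j, x j • Pi.single j (1 : ℤ) := by
      ext i; simp [Finset.sum_apply, Pi.single_apply]
    rw [hx, map_sum, Finset.smul_sum]
    refine Finset.sum_congr rfl fun j _ => ?_
    rw [map_zsmul, smul_comm]
    congr 1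
    ext i
    simp only [Pi.smul_apply, Pi.single_apply, smul_eq_mul]
    by_cases hij : i = j
    · subst hij
      rw [if_pos rfl, mul_one]
      have := hzero _ (fun m hm => hdiag m hm i i₀)
      omega
    · rw [if_neg hij, mul_zero]
      have := hzero _ (fun m hm => hdvd m hm i j)
      rw [if_neg hij] at this
      omega

/-- The scalar of `exists_int_eq_smul_of_forall_exists_sub_smul_mem` is congruent to the given
scalars: if `F = c • id` on `ℤ^k` with `0 < k` and `F x - s • x ∈ M ℤ^k` for all `x`, then `M ∣ c - s`. [folklore] -/
private theorem dvd_sub_of_eq_smul {k : ℕ} (hk : 0 < k) {F : (Fin k → ℤ) →+ (Fin k → ℤ)} {c : ℤ}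
    (hc : ∀ x, F x = c • x) {M : ℕ} {s : ℤ} (hs : ∀ x, ∃ y : Fin k → ℤ, F x - s • x = (M : ℤ) • y) :
    (M : ℤ) ∣ c - s := by
  obtain ⟨y, hy⟩ := hs (Pi.single ⟨0, hk⟩ 1)
  have h0 := congrFun hy ⟨0, hk⟩
  rw [hc] at h0
  simp only [Pi.sub_apply, Pi.smul_apply, Pi.single_eq_same, smul_eq_mul, mul_one] at h0
  exact ⟨_, h0⟩

/-- **Units congruent to a fixed multiple of `n` along a cofinal tower are `±1` times it**: if
`c ≡ n · a_M (mod M)` with `a_M` coprime to `M`, for every `M ≠ 0` divisible by `N` (`N ≠ 0`, `n ≠ 0`),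
then `c = n` or `c = -n`. [folklore] -/
private theorem eq_or_eq_neg_of_forall_dvd_sub_mul {N n : ℕ} (hN : N ≠ 0) (hn : n ≠ 0) {c : ℤ}
    (h : ∀ M : ℕ, N ∣ M → M ≠ 0 → ∃ a : ℤ, IsCoprime a (M : ℤ) ∧ (M : ℤ) ∣ c - n * a) :
    c = n ∨ c = -(n : ℤ) := by
  -- `n ∣ c`: take `M = N n`
  obtain ⟨a₀, -, hd₀⟩ := h (N * n) (dvd_mul_right N n) (mul_ne_zero hN hn)
  have hnc : (n : ℤ) ∣ c := by
    have h1 : (n : ℤ) ∣ c - n * a₀ :=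
      (Int.natCast_dvd_natCast.mpr (Dvd.intro_left N rfl)).trans hd₀
    have h2 : (n : ℤ) ∣ (n : ℤ) * a₀ := dvd_mul_right _ _
    simpa using h1.add h2
  obtain ⟨c', rfl⟩ := hnc
  -- `c'` is coprime to every `N t`, hence a unit of `ℤ`
  have hcop : ∀ t : ℕ, t ≠ 0 → IsCoprime c' (N * t : ℕ) := by
    intro t ht
    obtain ⟨a, ha, hd⟩ := h (N * t * n) (dvd_mul_of_dvd_left (dvd_mul_right N t) n)
      (mul_ne_zero (mul_ne_zero hN ht) hn)
    -- `N t n ∣ n (c' - a)` gives `N t ∣ c' - a`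
    have hd' : ((N * t : ℕ) : ℤ) ∣ c' - a := by
      have : ((N * t * n : ℕ) : ℤ) = (n : ℤ) * ((N * t : ℕ) : ℤ) := by push_cast; ring
      rw [this, ← mul_sub] at hd
      exact Int.dvd_of_mul_dvd_mul_left (by exact_mod_cast hn) hd
    -- `a` coprime to `N t n`, hence to `N t`; and `c' ≡ a (mod N t)`
    have ha' : IsCoprime a ((N * t : ℕ) : ℤ) :=
      ha.of_isCoprime_of_dvd_right (by exact_mod_cast Dvd.intro n rfl)
    obtain ⟨q, hq⟩ := hd'
    have : c' = a + ((N * t : ℕ) : ℤ) * q := by linarith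
    rw [this]
    exact (ha'.add_mul_left_left q)
  -- an integer coprime to `N t` for every `t ≥ 1` is a unit: test `t = 2` (if `c' = 0`) and `t = |c'|`
  have hunit : IsUnit c' := by
    rcases eq_or_ne c' 0 with rfl | hc0
    · exfalso
      have h2 := hcop 2 two_ne_zero
      rw [isCoprime_zero_left] at h2
      rcases Int.isUnit_iff.mp h2 with h2 | h2 <;> push_cast at h2 <;> omega
    · have hc := hcop c'.natAbs (Int.natAbs_ne_zero.mpr hc0)
      have hdv : c' ∣ ((N * c'.natAbs : ℕ) : ℤ) := by
        rw [Nat.cast_mul, Int.natCast_natAbs]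
        exact (self_dvd_abs c').mul_left _
      exact hc.isUnit_of_dvd' (dvd_refl _) hdv
  rcases Int.isUnit_iff.mp hunit with h1 | h1
  · left; rw [h1, mul_one]
  · right; rw [h1, mul_neg_one]

end TorsionScalarRigidity

/-! ## §2 Homomorphisms agreeing on division points up to a unit scalar -/

namespace AbelianVariety

open _root_.AlgebraicGeometry
open Literature.AlgebraicGeometry.Motives
open Literature.AlgebraicGeometry.Motives.AbelianVariety
open scoped MonObj

variable {A B : Motives.AbelianVariety ℂ}

/-- Addition of homomorphisms is pointwise on complex points: `(u + v)(P) = u(P) · v(P)`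
(Mumford §19; copy of the tree's `map_hom_add` at `k = L = ℂ`). [cite: MumfordAV1970, §19 (first paragraph)] -/
private theorem map_hom_add' (u v : A ⟶ B) (P : A.Points ℂ) :
    AlgPoints.map (u + v).hom.hom.hom P = AlgPoints.map u.hom.hom.hom P * AlgPoints.map v.hom.hom.hom P := by
  rw [AlgPoints.map_apply, hom_add, Grp.Hom.hom_mul, Mon.Hom.hom_mul, MonObj.comp_mul]
  rfl

/-- Composition is pointwise on complex points: `(f ≫ g)(P) = g(f(P))`. [folklore] -/
private theorem map_hom_comp' {C : Motives.AbelianVariety ℂ} (f : A ⟶ B) (g : B ⟶ C) (P : A.Points ℂ) :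
    AlgPoints.map (f ≫ g).hom.hom.hom P = AlgPoints.map g.hom.hom.hom (AlgPoints.map f.hom.hom.hom P) :=
  (Category.assoc _ _ _).symm

/-- A homomorphism annihilated by a nonzero integer is zero (`Hom(A, B)` is torsion-free: `ρ_r` is
faithful with values in `Hom_ℤ(H₁(A(ℂ); ℤ), H₁(B(ℂ); ℤ))`, a free `ℤ`-module). [cite: Lange2023AbelianVarietiesComplex, §1.1.2 Prop. 1.1.9 (PDF p. 19)] -/
theorem eq_zero_of_zsmul_eq_zero {n : ℤ} (hn : n ≠ 0) {χ : A ⟶ B} (h : n • χ = 0) : χ = 0 := by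
  obtain ⟨eB⟩ := nonempty_singularHomology_one_addEquiv_pi B
  apply hom_eq_of_singularHomology_map_one_eq
  intro c
  -- `(n • χ)_* c = n • χ_* c` and `(n • χ)_* = 0_* = 0`
  have h1 : (singularHomology.map ℤ ℤ (AlgPoints.mapContinuous (L := ℂ) (χ ≫ (n • 𝟙 B)).hom.hom.hom) 1).hom c
      = 0 := by
    rw [Preadditive.comp_zsmul, Category.comp_id, h, singularHomology_int_map_zero_one]
    rfl
  rw [singularHomology_int_map_comp_one_apply, singularHomology_int_map_zsmul_id_one_apply] at h1
  rw [singularHomology_int_map_zero_one, ModuleCat.hom_zero, LinearMap.zero_apply]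
  -- read in `ℤ^{2 dim B}`: `n • v = 0` with `n ≠ 0` forces `v = 0`
  apply eB.injective
  rw [map_zero]
  have h2 : n • eB ((singularHomology.map ℤ ℤ (AlgPoints.mapContinuous (L := ℂ) χ.hom.hom.hom) 1).hom c) = 0 := by
    rw [← map_zsmul, h1, map_zero]
  funext i
  have h3 := congrFun h2 i
  rw [Pi.smul_apply, smul_eq_mul, Pi.zero_apply] at h3
  exact (mul_eq_zero.mp h3).resolve_left hn

/-- **Homomorphisms `lam₁, lam₂ : A → B` of complex abelian varieties, `lam₁` an isogeny with quasi-inverse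
`ψ` (`lam₁ ≫ ψ = n`, `ψ ≫ lam₁ = n`, `n ≠ 0`), which agree on `A[M](ℂ)` up to a unit scalar
`a_M ∈ (ℤ/M)^×` — `lam₂(P) = lam₁(P)^{a_M}` — for every `M ≠ 0` of a cofinal tower `N ∣ M`, are equal
up to sign: `lam₂ = lam₁ ∨ lam₂ = -lam₁`.**  Mechanism of Lange's Cor. 2.4.11 (Serre's lemma) for the
endomorphism `β = lam₂ ≫ ψ` against the scalars `n a_M`: `ρ_r(β) ≡ n a_M (mod M)` on `H₁(A(ℂ); ℤ) ≅ ℤ^{2g}`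
for all `M` of the tower (monodromy `H₁/M ≅ A[M](ℂ)`), hence `ρ_r(β) = c` is a scalar, `β = c·1_A`
(faithfulness), `n lam₂ = c lam₁`, and `c ≡ n a_M (mod M)` with `a_M` units forces `c = ±n`.
[cite: Lange2023AbelianVarietiesComplex, §2.4.1 proof of Cor. 2.4.11 (PDF p. 117); §1.1.2–§1.1.3 (PDF pp. 19–23)]
[cite: Milne1986AbelianVarieties, Prop. 17.5 (b)] -/
theorem eq_or_eq_neg_of_forall_torsionPoints_map_eq_pow (lam₁ lam₂ : A ⟶ B)
    (hψ : ∃ (ψ : B ⟶ A) (n : ℕ), n ≠ 0 ∧ lam₁ ≫ ψ = (n : ℤ) • 𝟙 A ∧ ψ ≫ lam₁ = (n : ℤ) • 𝟙 B)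
    {N : ℕ} (hN : N ≠ 0)
    (h : ∀ M : ℕ, N ∣ M → M ≠ 0 → ∃ a : ℤ, IsCoprime a (M : ℤ) ∧
      ∀ P ∈ A.torsionPoints ℂ M, AlgPoints.map lam₂.hom.hom.hom P = AlgPoints.map lam₁.hom.hom.hom P ^ a) :
    lam₂ = lam₁ ∨ lam₂ = -lam₁ := by
  classical
  obtain ⟨ψ, n, hn, hψ₁, hψ₂⟩ := hψ
  obtain ⟨e⟩ := nonempty_singularHomology_one_addEquiv_pi A
  set β : A ⟶ A := lam₂ ≫ ψ with hβdef
  -- the `H₁`-endomorphism of `β`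
  set βH : singularHomology ℤ ℤ (A.Points ℂ) 1 →ₗ[ℤ] singularHomology ℤ ℤ (A.Points ℂ) 1 :=
    (singularHomology.map ℤ ℤ (AlgPoints.mapContinuous (L := ℂ) β.hom.hom.hom) 1).hom with hβH
  -- Step 1: `ρ_r(β) ≡ n a_M (mod M)` for every level of the tower
  have hcong : ∀ M : ℕ, N ∣ M → M ≠ 0 → ∃ a : ℤ, IsCoprime a (M : ℤ) ∧
      ∀ c : singularHomology ℤ ℤ (A.Points ℂ) 1, ∃ y : singularHomology ℤ ℤ (A.Points ℂ) 1,
        βH c - ((n : ℤ) * a) • c = M • y := by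
    intro M hNM hM0
    obtain ⟨a, ha, hP⟩ := h M hNM hM0
    refine ⟨a, ha, fun c => ?_⟩
    -- `φ := β + (1 - n a) • 𝟙 A` fixes every `M`-division point
    have hfix : ∀ P ∈ A.torsionPoints ℂ M,
        IsMonHom.monoidHom (β + ((1 - (n : ℤ) * a) • 𝟙 A)).hom.hom.hom (specOver ℂ ℂ) P = P := by
      intro P hPM
      rw [IsMonHom.monoidHom_apply, ← AlgPoints.map_apply, map_hom_add', map_zsmul_id_hom, hβdef,
        map_hom_comp', hP P hPM, map_hom_zpow, ← map_hom_comp', hψ₁, map_zsmul_id_hom, ← zpow_mul,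
        ← zpow_add]
      have : (n : ℤ) * a + (1 - (n : ℤ) * a) = 1 := by ring
      rw [this, zpow_one]
    obtain ⟨y, hy⟩ := exists_nsmul_eq_singularHomology_map_sub_of_forall_torsionPoints _ hM0 hfix c
    refine ⟨y, ?_⟩
    rw [singularHomology_int_map_add_one, ModuleCat.hom_add, LinearMap.add_apply,
      singularHomology_int_map_zsmul_id_one_apply, sub_zsmul, one_zsmul] at hy
    rw [← hy, hβH]
    abel
  -- Step 2: transport to `ℤ^{2g}` and conclude that `ρ_r(β)` is an integer scalar `c₀`
  set F : (Fin (2 * A.dim) → ℤ) →+ (Fin (2 * A.dim) → ℤ) :=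
    e.toAddMonoidHom.comp (βH.toAddMonoidHom.comp e.symm.toAddMonoidHom) with hF
  have hFtower : ∀ M : ℕ, N ∣ M → M ≠ 0 → ∃ a : ℤ, IsCoprime a (M : ℤ) ∧
      ∀ x, ∃ y : Fin (2 * A.dim) → ℤ, F x - ((n : ℤ) * a) • x = (M : ℤ) • y := by
    intro M hNM hM0
    obtain ⟨a, ha, hc⟩ := hcong M hNM hM0
    refine ⟨a, ha, fun x => ?_⟩
    obtain ⟨y, hy⟩ := hc (e.symm x)
    refine ⟨e y, ?_⟩
    have h1 : F x = e (βH (e.symm x)) := rfl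
    rw [h1, natCast_zsmul, ← map_nsmul e, ← hy, map_sub, map_zsmul, e.apply_symm_apply]
  obtain ⟨c₀, hc₀⟩ := TorsionScalarRigidity.exists_int_eq_smul_of_forall_exists_sub_smul_mem F
    (fun m hm => ⟨N * m, Dvd.intro_left N rfl, mul_ne_zero hN hm, by
      obtain ⟨a, -, hx⟩ := hFtower (N * m) (Dvd.intro m rfl) (mul_ne_zero hN hm)
      exact ⟨(n : ℤ) * a, hx⟩⟩)
  have hβH_eq : ∀ c, βH c = c₀ • c := fun c => by
    have h1 : F (e c) = e (βH c) := by simp [hF]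
    apply e.injective
    rw [← h1, hc₀, map_zsmul]
  -- Step 3: `β = c₀ · 1_A` (faithfulness of `ρ_r`)
  have hβ : β = c₀ • 𝟙 A := by
    apply hom_eq_of_singularHomology_map_one_eq
    intro c
    rw [singularHomology_int_map_zsmul_id_one_apply]
    exact hβH_eq c
  -- Step 4: `n lam₂ = c₀ lam₁`
  have hnl : (n : ℤ) • lam₂ = c₀ • lam₁ := by
    calc (n : ℤ) • lam₂ = lam₂ ≫ ((n : ℤ) • 𝟙 B) := by rw [Preadditive.comp_zsmul, Category.comp_id]
      _ = (lam₂ ≫ ψ) ≫ lam₁ := by rw [← hψ₂, Category.assoc]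
      _ = c₀ • lam₁ := by rw [← hβdef, hβ, Preadditive.zsmul_comp, Category.id_comp]
  -- Step 5: `c₀ = ± n` unless `dim A = 0` (then every homomorphism out of `A` is `0`)
  rcases Nat.eq_zero_or_pos (2 * A.dim) with hk | hk
  · left
    apply hom_eq_of_singularHomology_map_one_eq
    intro c
    have : c = 0 := by
      apply e.injective
      ext i
      exact Fin.elim0 (hk ▸ i)
    rw [this, map_zero, map_zero]
  · have hdvd : ∀ M : ℕ, N ∣ M → M ≠ 0 → ∃ a : ℤ, IsCoprime a (M : ℤ) ∧ (M : ℤ) ∣ c₀ - n * a := by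
      intro M hNM hM0
      obtain ⟨a, ha, hx⟩ := hFtower M hNM hM0
      exact ⟨a, ha, TorsionScalarRigidity.dvd_sub_of_eq_smul hk hc₀ hx⟩
    rcases TorsionScalarRigidity.eq_or_eq_neg_of_forall_dvd_sub_mul hN hn hdvd with hc | hc
    · left
      have h0 : (n : ℤ) • (lam₂ - lam₁) = 0 := by rw [smul_sub, hnl, hc, sub_self]
      exact sub_eq_zero.mp (eq_zero_of_zsmul_eq_zero (Int.natCast_ne_zero.mpr hn) h0)
    · right
      have h0 : (n : ℤ) • (lam₂ + lam₁) = 0 := by rw [smul_add, hnl, hc, neg_smul, neg_add_cancel]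
      exact eq_neg_of_add_eq_zero_left (eq_zero_of_zsmul_eq_zero (Int.natCast_ne_zero.mpr hn) h0)

/-! ## §3 Sign exclusion for the Weil-pairing towers of two ample divisors -/

/-- **Two AMPLE divisors cannot have inverse Weil-pairing towers.**  On a positive-dimensional complex
abelian variety `A`, ample Cartier divisors `Θ₁, Θ₂` and a cofinal tower `N ∣ M` of levels, it is
impossible that `ē^{Θ₂}_M(P, Q) = ē^{Θ₁}_M(P, Q)⁻¹` for all `P, Q ∈ A[M](ℂ)` and all `M` of the tower:
`ē^{Θ₁+Θ₂}_M = ē^{Θ₁}_M · ē^{Θ₂}_M ≡ 1` (Lang VII §2 Prop. 3) puts every `Q ∈ A[ℓᵏ](ℂ)`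
(`ℓ = 2N`, `k = #K(Θ₁+Θ₂) + 1`) in the radical of the level pairing of the AMPLE divisor `Θ₁ + Θ₂`,
whence `Q^{ℓ^{#K(Θ₁+Θ₂)}} = 1` (Lang VII §2 Prop. 4 with Mumford §6 App. 1: `K(Θ₁+Θ₂)` is finite)
— but `A[ℓᵏ](ℂ) ≅ (ℤ/ℓᵏ)^{2g}` has an element of order `ℓᵏ`.
[cite: Lang1983AbelianVarieties, Ch. VII §2 Prop. 3 and Prop. 4] [cite: MumfordAV1970, §6 Application 1 (p. 60)]
[cite: Lange2023AbelianVarietiesComplex, §1.1.2 Prop. 1.1.14 (PDF p. 22)] -/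
theorem not_forall_weilPairingLevel_eq_inv_of_isAmple (hA : 0 < A.dim) {Θ₁ Θ₂ : CartierDivisor A.X.left}
    (h₁ : Θ₁.IsAmple) (h₂ : Θ₂.IsAmple) {N : ℕ} (hN : N ≠ 0)
    (h : ∀ M : ℕ, N ∣ M → ∀ (hM : (M : ℂ) ≠ 0) (P Q : A.torsionPoints ℂ M),
      haveI := Motives.AbelianVariety.isDominant_toSchemeHom_zsmul_of_ne_zero A hM
      A.weilPairingLevel Θ₂ P Q = (A.weilPairingLevel Θ₁ P Q)⁻¹) : False := by
  classical
  have hX : (Θ₁ + Θ₂).IsAmple := h₁.add h₂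
  set c := Nat.card (A.KTheta (Θ₁ + Θ₂)) with hc
  set ℓ := 2 * N with hℓ
  have hℓ1 : 1 < ℓ := by omega
  have hℓC : (ℓ : ℂ) ≠ 0 := by exact_mod_cast (show ℓ ≠ 0 by omega)
  set M := ℓ ^ (c + 1) with hM
  have hM0 : M ≠ 0 := pow_ne_zero _ (by omega)
  have hMC : (M : ℂ) ≠ 0 := by exact_mod_cast hM0
  have hNM : N ∣ M := (Dvd.intro_left 2 rfl : N ∣ ℓ).trans (dvd_pow_self ℓ (Nat.succ_ne_zero c))
  haveI := Motives.AbelianVariety.isDominant_toSchemeHom_zsmul_of_ne_zero A hMC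
  -- every `Q ∈ A[M](ℂ)` lies in the radical of `ē^{Θ₁+Θ₂}_M`, hence `Q ^ ℓ ^ c = 1`
  have hrad : ∀ Q : A.torsionPoints ℂ ((ℓ ^ (c + 1) : ℕ) : ℤ), (Q : A.Points ℂ) ^ (ℓ ^ c) = 1 := by
    intro Q
    refine A.weilPairingLevel_radical_pow_card_KTheta_of_one_lt hX hℓ1 hℓC (c + 1) Q fun P => ?_
    rw [weilPairingLevel_add, h M hNM hMC P Q, mul_inv_cancel₀ (weilPairingLevel_ne_zero Θ₁ P Q)]
  -- but `A[M](ℂ) ≅ (ℤ/M)^{2g}` contains an element of order `M = ℓ^{c+1}`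
  obtain ⟨ε⟩ := nonempty_torsionPoints_mulEquiv_pi_zmod A M hM0
  set i₀ : Fin (2 * A.dim) := ⟨0, by omega⟩
  set Q := ε.symm (Multiplicative.ofAdd (Pi.single i₀ (1 : ZMod M) : Fin (2 * A.dim) → ZMod M)) with hQ
  have hQ1 : (Q : A.Points ℂ) ^ (ℓ ^ c) = 1 := hrad Q
  have hQ2 : Q ^ (ℓ ^ c) = 1 := Subtype.ext (by simpa using hQ1)
  have h3 : (Multiplicative.ofAdd (Pi.single i₀ (1 : ZMod M) : Fin (2 * A.dim) → ZMod M)) ^ (ℓ ^ c) = 1 := by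
    have := congrArg ε hQ2
    rwa [map_pow, hQ, ε.apply_symm_apply, map_one] at this
  have h4 : ((ℓ ^ c : ℕ) : ZMod M) = 0 := by
    have h5 := congrArg (fun x => (Multiplicative.toAdd x : Fin (2 * A.dim) → ZMod M) i₀) h3
    simpa [i₀] using h5
  rw [ZMod.natCast_eq_zero_iff] at h4
  have h6 : M ≤ ℓ ^ c := Nat.le_of_dvd (pow_pos (by omega) c) h4
  have h7 : ℓ ^ c < ℓ ^ (c + 1) := Nat.pow_lt_pow_right hℓ1 (Nat.lt_succ_self c)
  omega

/-! ## §4 Edition 2: the isogeny form (quasi-inverse supplied by the tree) -/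

/-- **Isogeny form of `eq_or_eq_neg_of_forall_torsionPoints_map_eq_pow`.**  For an ISOGENY
`lam₁ : A → B` of complex abelian varieties (the tree's `IsIsogeny`: surjective and finite) and a
homomorphism `lam₂ : A → B` agreeing with `lam₁` on `A[M](ℂ)` up to a unit scalar along a cofinal
tower `N ∣ M`, `lam₂ = lam₁` or `lam₂ = -lam₁`.  The two-sided quasi-inverse `ψ`
(`lam₁ ≫ ψ = n`, `ψ ≫ lam₁ = n`) is the tree's: a surjection has a quasi-section
(`exists_comp_eq_nsmul_id_of_surjective`, Lange–Birkenhake Prop. 1.1.12/Cor. 2.4.24), which is then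
an isogeny (`IsIsogeny.isIsogeny_and_kerPoints_le_of_comp_eq_nsmul_id`) and commutes past `lam₁`
(`IsIsogeny.comp_eq_nsmul_id_of_comp_eq_nsmul_id`).
[cite: Lange2023AbelianVarietiesComplex, §1.1.2 Prop. 1.1.12 (PDF p. 21) and §2.4.1 Cor. 2.4.11 (PDF p. 117)]
[cite: Milne1986AbelianVarieties, Prop. 17.5 (b)] -/
theorem eq_or_eq_neg_of_isIsogeny_of_forall_torsionPoints_map_eq_pow (lam₁ lam₂ : A ⟶ B)
    (h₁ : IsIsogeny lam₁) {N : ℕ} (hN : N ≠ 0)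
    (h : ∀ M : ℕ, N ∣ M → M ≠ 0 → ∃ a : ℤ, IsCoprime a (M : ℤ) ∧
      ∀ P ∈ A.torsionPoints ℂ M, AlgPoints.map lam₂.hom.hom.hom P = AlgPoints.map lam₁.hom.hom.hom P ^ a) :
    lam₂ = lam₁ ∨ lam₂ = -lam₁ := by
  haveI : AlgebraicGeometry.Surjective (Hom.toSchemeHom lam₁) := h₁.1
  obtain ⟨t, n, hn, ht⟩ := exists_comp_eq_nsmul_id_of_surjective lam₁
  have htiso : IsIsogeny t := (h₁.isIsogeny_and_kerPoints_le_of_comp_eq_nsmul_id hn ht).1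
  have ht' : lam₁ ≫ t = n • 𝟙 A := htiso.comp_eq_nsmul_id_of_comp_eq_nsmul_id ht
  refine eq_or_eq_neg_of_forall_torsionPoints_map_eq_pow lam₁ lam₂ ⟨t, n, hn, ?_, ?_⟩ hN h
  · rw [ht', natCast_zsmul]
  · rw [ht, natCast_zsmul]

end AbelianVariety

end Literature.AlgebraicGeometry.HodgeTheory
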